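import Literature.Probability.LatticeModels.CoarseCellHyperVolumes
import Literature.Probability.LatticeModels.CoarseCellMixingDefectsMarkovBlocks
import HarnessLib

/-!
# Coarse cells with hyperedge defects, III: the statements of the two-species engine

Statements ("named targets", each a `def … : Prop`) of the two-species Dobrushin–Shlosman /
van den Berg–Maes engine with a Kotecký–Preiss-rare second defect species, in the vocabulary of
`CoarseCellHyperVolumes` (general joint volumes `IsHVol`, admissible pairs `HyperAdm`, defect
objects `HObj`). They are stated here, ahead of their proofs in the companion files
`CoarseCellHyper{KP,Chain,ClusterTerm,Far,Cube,Mark,Decay,Root}`, so that the composition of the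
engine can be kernel-checked against fixed interfaces (crux `RobustYangMills`, line
local-ac-open-certificate, skeleton stubs `stub_hyperKP`, `stub_hyperChain`,
`stub_hyperClusterTerm`, `stub_hyperFar`, `stub_hyperAssembly`):

* `HyperKPBound` — the weighted Kotecký–Preiss entropy bound: total weight of the non-empty
  cluster shapes attached to a seed, for object weights satisfying a KP condition on a finite
  universe with a symmetric linking relation (Kotecký–Preiss 1986, (1)–(3); Friedli–Velenik 2017,
  Thm. 5.4);
* `HyperChainRule d` — the chain rule of the block recursion with two defect species: influence of
  an admissible boundary pair on an observable of the ordinary sites of volume cells `Y` and of the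
  ACTIVITY of volume marks `M ⊇` the marks whose territory meets `Y`, vanishing when a cell of `Y`
  is bad or a mark of `M` is active, from single-CELL and single-MARK influence bounds
  (marks are frozen first; a frozen inactive mark is never read, `IsHyperMarkovV`);
* `HyperClusterTerm d` — the influence of one near defect-cluster term `Ψ · 1_{defectCluster = K}`
  (resample the block `core ∪ ⋃ bodies(K)`; Peierls weight `∏_{o ∈ K} w(o)` by `HyperPeierlsL`;
  exact locality of the block kernel in its ring cells and in the activity of the volume marks
  linked to `K` or seeding, by `IsHyperMarkovV`; then `HyperChainRule`);
* `HyperFarBound d` — defect clusters reaching far from their seed are improbable (weighted chain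
  counting: an object transports reach `diam(body) + 1`, paid by its weight);
* `HyperCovDecaySpan d` — the engine: exponential decay of covariances of cell-local bounded
  observables of the ordinary sites under every Gibbs measure, for specifications on a coarse
  `d`-torus with the hyper-Markov property, the good-exterior finite-size condition, the local
  two-species Peierls bound, kernel-uniform rarity of active marks and the SPAN-weighted
  Kotecký–Preiss condition `∑_{v ∋ c} r_v e^{lam·span(terr v)} ≤ q` (the span — cells plus
  diameter of the territory — is what a hyperedge must be charged: with the cardinality alone the
  statement is false, two-cell territories at distance `L` transporting influence over `L`).

Sources: R. L. Dobrushin, S. B. Shlosman (1985), §2; J. van den Berg, C. Maes, Ann. Probab. 22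
(1994), §2; R. Kotecký, D. Preiss, CMP 103 (1986); S. Friedli, Y. Velenik (CUP 2017), §5.4;
H.-O. Georgii (2011), Ch. 8. The two-species form is folklore-level bookkeeping; these are
definitions of statements, no theorem is claimed in this file.
-/

noncomputable section

open MeasureTheory
open scoped Classical

namespace Literature.Probability.LatticeModels

universe u v

/-! ### The weighted Kotecký–Preiss entropy bound -/

/-- **Weighted Kotecký–Preiss entropy bound for cluster shapes.** On a finite universe `U` of a
type with a symmetric linking relation `adj`, if the object weights `w ≥ 0` satisfy the
Kotecký–Preiss condition `∑_{o' ∈ U, adj o o'} w o' e^{a o'} ≤ a o` for every `o ∈ U` (some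
`a ≥ 0`), then the total weight `∑_K ∏_{o ∈ K} w o` of the non-empty cluster shapes `K ⊆ U`
attached to the seed `Sd` (`IsClusterShape adj Sd K`: every object of `K` is reached from a seed
object of `K` through linked objects of `K`) is at most `exp(∑_{s ∈ Sd ∩ U} w s e^{a s}) - 1`
(decompose a shape into its connected components, each through a seed object; the rooted tree
bound `∑_{C ∋ s connected} ∏ w ≤ w s e^{a s}`; the gas-of-components inequality).
[cite: KoteckyPreiss1986, (1)-(3)] -/
def HyperKPBound : Prop :=
  ∀ {α : Type u} [DecidableEq α] (adj : α → α → Prop), (∀ a b, adj a b → adj b a) →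
    ∀ (U Sd : Finset α) (w a : α → ℝ), (∀ o, 0 ≤ w o) → (∀ o, 0 ≤ a o) →
      (∀ o ∈ U, ∑ o' ∈ U.filter (fun o' => adj o o'), w o' * Real.exp (a o') ≤ a o) →
      ∑ K ∈ U.powerset.filter (fun K => IsClusterShape adj Sd K ∧ K.Nonempty), ∏ o ∈ K, w o ≤
        Real.exp (∑ s ∈ U.filter (fun s => s ∈ Sd), w s * Real.exp (a s)) - 1

/-! ### The chain rule with two defect species -/

/-- **The hyper chain rule.** Let `γ` be a specification with the hyper-Markov property on general
joint volumes, goodness local in the ordinary sites, ordinary sites with singleton territories.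
Suppose that, relative to a source region `F`, for EVERY volume `Λ` and every `F`-admissible
boundary pair, the influence on `[0,1]`-valued observables of the ordinary sites of a cell `x` is
at most `δc x`, and the influence on the kernel probability that a volume mark `u` is active is at
most `δm u`. Then for a volume `Λ`, volume cells `Y`, volume marks `M` containing every volume mark
whose territory meets `Y`, and a measurable `H` with `|H| ≤ λ` reading the ordinary sites of `Y`
and the ACTIVITY of `M`, vanishing whenever a cell of `Y` is bad or a mark of `M` is active, the
influence of an `F`-admissible pair on `γ_Λ H` is at most `2 λ (∑_{y ∈ Y} δc y + ∑_{u ∈ M} δm u)`.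
[cite: DobrushinShlosman1985, §2] -/
def HyperChainRule (d : ℕ) : Prop :=
  ∀ {μ : Fin d → ℕ} {V : Type u} {S : Type v} [MeasurableSpace S] [Fintype V] [DecidableEq V]
    (cell : V → CoarseIdx μ) (terr : V → Finset (CoarseIdx μ)) (act : V → Set S)
    (γ : Specification V S) (good : CoarseIdx μ → Set (V → S)),
    IsSpecification γ →
    (∀ (c : CoarseIdx μ) (σ τ : V → S), (∀ v, act v = ∅ → cell v = c → σ v = τ v) →
      (σ ∈ good c ↔ τ ∈ good c)) →
    (∀ v, act v = ∅ → terr v = {cell v}) → (∀ v, MeasurableSet (act v)) →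
    IsHyperMarkovV cell terr act γ →
    ∀ (F : Finset (CoarseIdx μ)) (δc : CoarseIdx μ → ℝ) (δm : V → ℝ),
      (∀ x, 0 ≤ δc x) → (∀ u, 0 ≤ δm u) →
      (∀ (Λ : Finset V), IsHVol cell terr act Λ →
        ∀ (x : CoarseIdx μ) (g : (V → S) → ℝ), Measurable g → (∀ σ, 0 ≤ g σ ∧ g σ ≤ 1) →
        DependsOn g {v | act v = ∅ ∧ cell v = x} →
        ∀ ζ ζ' : V → S, HyperAdm cell terr act good F Λ ζ ζ' →
          |∫ σ, g σ ∂(γ Λ ζ) - ∫ σ, g σ ∂(γ Λ ζ')| ≤ δc x) →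
      (∀ (Λ : Finset V), IsHVol cell terr act Λ → ∀ u ∈ Λ, act u ≠ ∅ →
        ∀ ζ ζ' : V → S, HyperAdm cell terr act good F Λ ζ ζ' →
          |(γ Λ ζ).real {σ | σ u ∈ act u} - (γ Λ ζ').real {σ | σ u ∈ act u}| ≤ δm u) →
      ∀ (Λ : Finset V), IsHVol cell terr act Λ →
      ∀ (Y : Finset (CoarseIdx μ)), (∀ y ∈ Y, VolCell cell act Λ y) →
      ∀ (M : Finset V), M ⊆ Λ → (∀ u ∈ M, act u ≠ ∅) →
        (∀ u ∈ Λ, act u ≠ ∅ → (∃ y ∈ Y, y ∈ terr u) → u ∈ M) →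
      ∀ (H : (V → S) → ℝ), Measurable H → ∀ (lam : ℝ), (∀ σ, |H σ| ≤ lam) →
        ActDependsOn act H {v | act v = ∅ ∧ cell v ∈ Y} ↑M →
        (∀ σ, (∃ y ∈ Y, σ ∉ good y) → H σ = 0) →
        (∀ σ, (∃ u ∈ M, σ u ∈ act u) → H σ = 0) →
      ∀ ζ ζ' : V → S, HyperAdm cell terr act good F Λ ζ ζ' →
        |∫ σ, H σ ∂(γ Λ ζ) - ∫ σ, H σ ∂(γ Λ ζ')| ≤
          2 * lam * (∑ y ∈ Y, δc y + ∑ u ∈ M, δm u)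

/-! ### The influence of one near defect-cluster term -/

/-- **The hyper cluster term.** Let `γ` be a specification with the hyper-Markov property and the
local two-species Peierls bound at levels `(q, r)`, and suppose the single-cell / single-mark
influence bounds `δc`, `δm` hold relative to `F` (as in `HyperChainRule`). Let `Λ'` be a volume
with an `F`-admissible pair, `core` a set of cells, `Sd` a set of seed objects (seed cells: volume
cells off `F`; seed sites: volume marks) and `K` a cluster shape for `Sd` in the object graph
(bodies within coarse distance `1`), whose block `B = core ∪ ⋃_{o ∈ K} body o` has its
`1`-neighbourhood off `F`; assume the volume cells adjacent to the core outside `B` are seed cells,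
and the volume marks outside `B` whose territory comes within `1` of the core or of a seed cell are
seed objects. Then for a measurable `Ψ`, `|Ψ| ≤ λ`, reading the ordinary sites of the seed cells
and of `B` and the sites of `K`, and the seed sites only through their activity, vanishing when a
seed site outside `K` is active, the influence of the pair on `γ_{Λ'}(Ψ · 1_{defectCluster = K})`
is at most `2 λ (∏_{o ∈ K} w o) (∑_{ring cells} δc + ∑_{ring marks} δm)`: the ring cells are the
volume cells of `(seed cells ∪ N₁(B)) ∖ B`, the ring marks the volume marks outside `B` seeding or
linked to `K`. [cite: BergMaes1994, §2] -/
def HyperClusterTerm (d : ℕ) : Prop :=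
  ∀ {μ : Fin d → ℕ} {V : Type u} {S : Type v} [MeasurableSpace S] [Fintype V] [DecidableEq V]
    (cell : V → CoarseIdx μ) (terr : V → Finset (CoarseIdx μ)) (act : V → Set S)
    (γ : Specification V S) (good : CoarseIdx μ → Set (V → S)) (q : ℝ) (r : V → ℝ),
    IsSpecification γ →
    (∀ (c : CoarseIdx μ) (σ τ : V → S), (∀ v, act v = ∅ → cell v = c → σ v = τ v) →
      (σ ∈ good c ↔ τ ∈ good c)) → (∀ c, MeasurableSet (good c)) →
    (∀ v, act v = ∅ → terr v = {cell v}) → (∀ v, MeasurableSet (act v)) →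
    IsHyperMarkovV cell terr act γ → 0 ≤ q → (∀ v, 0 ≤ r v) →
    HyperPeierlsL cell terr act γ good q r →
    ∀ (F : Finset (CoarseIdx μ)) (δc : CoarseIdx μ → ℝ) (δm : V → ℝ),
      (∀ x, 0 ≤ δc x) → (∀ u, 0 ≤ δm u) →
      (∀ (Λ : Finset V), IsHVol cell terr act Λ →
        ∀ (x : CoarseIdx μ) (g : (V → S) → ℝ), Measurable g → (∀ σ, 0 ≤ g σ ∧ g σ ≤ 1) →
        DependsOn g {v | act v = ∅ ∧ cell v = x} →
        ∀ ζ ζ' : V → S, HyperAdm cell terr act good F Λ ζ ζ' →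
          |∫ σ, g σ ∂(γ Λ ζ) - ∫ σ, g σ ∂(γ Λ ζ')| ≤ δc x) →
      (∀ (Λ : Finset V), IsHVol cell terr act Λ → ∀ u ∈ Λ, act u ≠ ∅ →
        ∀ ζ ζ' : V → S, HyperAdm cell terr act good F Λ ζ ζ' →
          |(γ Λ ζ).real {σ | σ u ∈ act u} - (γ Λ ζ').real {σ | σ u ∈ act u}| ≤ δm u) →
      ∀ (Λ' : Finset V), IsHVol cell terr act Λ' →
      ∀ (ζ ζ' : V → S), HyperAdm cell terr act good F Λ' ζ ζ' →
      ∀ (core : Finset (CoarseIdx μ)) (Sd K : Finset (HObj μ V)),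
        IsClusterShape (HAdj terr) Sd K →
        (∀ c : CoarseIdx μ, (∃ p ∈ core ∪ objBlock (terr := terr) K, cdist p c ≤ 1) → c ∉ F) →
        (∀ c, (Sum.inl c : HObj μ V) ∈ Sd → VolCell cell act Λ' c ∧ c ∉ F) →
        (∀ u, (Sum.inr u : HObj μ V) ∈ Sd → u ∈ Λ' ∧ act u ≠ ∅) →
        (∀ c, c ∉ core ∪ objBlock (terr := terr) K → (∃ p ∈ core, cdist p c ≤ 1) →
          VolCell cell act Λ' c → (Sum.inl c : HObj μ V) ∈ Sd) →
        (∀ u ∈ Λ', act u ≠ ∅ → ¬ terr u ⊆ core ∪ objBlock (terr := terr) K →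
          (∃ a ∈ terr u, ∃ p, (p ∈ core ∨ (Sum.inl p : HObj μ V) ∈ Sd) ∧ cdist p a ≤ 1) →
          (Sum.inr u : HObj μ V) ∈ Sd) →
      ∀ (Ψ : (V → S) → ℝ), Measurable Ψ → ∀ (lam : ℝ), (∀ σ, |Ψ σ| ≤ lam) →
        ActDependsOn act Ψ
          ({v | act v = ∅ ∧ ((Sum.inl (cell v) : HObj μ V) ∈ Sd ∨
              cell v ∈ core ∪ objBlock (terr := terr) K)} ∪ {v | (Sum.inr v : HObj μ V) ∈ K})
          {v | (Sum.inr v : HObj μ V) ∈ Sd} →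
        (∀ σ, (∃ u, (Sum.inr u : HObj μ V) ∈ Sd ∧ (Sum.inr u : HObj μ V) ∉ K ∧ σ u ∈ act u) →
          Ψ σ = 0) →
        |∫ σ, Ψ σ * ({σ | defectCluster terr good act Finset.univ Sd σ = K} : Set (V → S)).indicator
              1 σ ∂(γ Λ' ζ) -
            ∫ σ, Ψ σ * ({σ | defectCluster terr good act Finset.univ Sd σ = K} : Set (V → S)).indicator
              1 σ ∂(γ Λ' ζ')| ≤
          2 * lam * (∏ o ∈ K, objWeight q r o) *
            (∑ y ∈ (((Finset.univ.filter fun c => (Sum.inl c : HObj μ V) ∈ Sd) ∪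
                  fatten Finset.univ (core ∪ objBlock (terr := terr) K) 1) \
                    (core ∪ objBlock (terr := terr) K)).filter
                (fun c => VolCell cell act Λ' c), δc y +
              ∑ u ∈ Λ'.filter (fun u => act u ≠ ∅ ∧ ¬ terr u ⊆ core ∪ objBlock (terr := terr) K ∧
                  ((Sum.inr u : HObj μ V) ∈ Sd ∨ ∃ k ∈ K, HAdj terr k (Sum.inr u))), δm u)

/-! ### Far defect clusters are improbable -/

/-- **The hyper far bound.** Let `γ` be a specification with the local two-species Peierls bound at
levels `(q, r)`, and let the object weights `w` (`q` for cells, `r_v` for sites) satisfy the path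
condition `∑_{o' ~ o} w o' θ₁^{-(diam(body o')+1)} e^{A o'} ≤ ε₀ e^{A o}` for every object `o`
(`0 < θ₁ ≤ 1`, `ε₀ ≤ 1/2`). Let `Λ'` be a volume and `ζ` an exterior whose frozen sites with
territory not inside `F` are inactive and whose frozen ordinary sites off `F` are good, `x` a cell
with `F` at coarse distance `≥ R + 2`, and `Sd` seed objects each with a body cell within `ρ₀ ≤ R`
of `x`. Then the `γ_{Λ'}(· | ζ)`-probability that the defect cluster attached to `Sd` contains an
object whose body leaves the ball of radius `R` about `x` is at most
`2 θ₁^{R-ρ₀} ∑_{s ∈ Sd} w s θ₁^{-(diam(body s)+1)} e^{A s}` (a defective chain from a seed to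
such an object transports reach at most `∑ (diam(body)+1)`; Peierls on the chain; weighted path
counting). [cite: BergMaes1994, §2] -/
def HyperFarBound (d : ℕ) : Prop :=
  ∀ {μ : Fin d → ℕ} {V : Type u} {S : Type v} [MeasurableSpace S] [Fintype V] [DecidableEq V]
    (cell : V → CoarseIdx μ) (terr : V → Finset (CoarseIdx μ)) (act : V → Set S)
    (γ : Specification V S) (good : CoarseIdx μ → Set (V → S)) (q : ℝ) (r : V → ℝ),
    IsSpecification γ → (∀ c, MeasurableSet (good c)) → (∀ v, MeasurableSet (act v)) →
    (∀ v, act v = ∅ → terr v = {cell v}) →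
    0 ≤ q → (∀ v, 0 ≤ r v) → HyperPeierlsL cell terr act γ good q r →
    ∀ (θ₁ ε₀ : ℝ) (A : HObj μ V → ℝ), 0 < θ₁ → θ₁ ≤ 1 → 0 ≤ ε₀ → ε₀ ≤ 1 / 2 →
    (∀ o : HObj μ V, ∑ o' ∈ Finset.univ.filter (fun o' => HAdj terr o o'),
        objWeight q r o' * θ₁⁻¹ ^ (tdiam (body terr o') + 1) * Real.exp (A o') ≤
          ε₀ * Real.exp (A o)) →
    ∀ (F : Finset (CoarseIdx μ)) (Λ' : Finset V), IsHVol cell terr act Λ' →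
    ∀ (ζ : V → S), (∀ v, v ∉ Λ' → ¬ terr v ⊆ F → ζ v ∉ act v) →
      (∀ v, v ∉ Λ' → act v = ∅ → cell v ∉ F → ζ ∈ good (cell v)) →
    ∀ (x : CoarseIdx μ) (R ρ₀ : ℕ), (∀ f ∈ F, R + 2 ≤ cdist x f) → ρ₀ ≤ R →
    ∀ (Sd : Finset (HObj μ V)), (∀ o ∈ Sd, ∃ c ∈ body terr o, cdist x c ≤ ρ₀) →
      (γ Λ' ζ).real {σ | ∃ o ∈ defectCluster terr good act Finset.univ Sd σ,
          ¬ (body terr o ⊆ Finset.univ.filter fun c : CoarseIdx μ => cdist x c ≤ R)} ≤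
        2 * θ₁ ^ (R - ρ₀) *
          ∑ s ∈ Sd, objWeight q r s * θ₁⁻¹ ^ (tdiam (body terr s) + 1) * Real.exp (A s)

/-! ### The engine -/

/-- **The two-species coarse-cell engine, span-weighted** (covariance form). For every window `n`
there are `q₀, κₑ > 0`, `lam, C ≥ 0` (depending on `d, n` only) such that: for every specification
`γ` on a coarse `d`-torus (`≥ 4n+3` cells per axis) with territories / activity events (ordinary
sites: singleton territories), the hyper-Markov property on general joint volumes, the
good-exterior finite-size condition `(n, ε)` with `ε · shellCount d n ≤ 3/4`, the local two-species
kernel-uniform Peierls bound at levels `(q, r)` with `q ≤ q₀`, kernel-uniform rarity of active marks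
at level `r`, and the span-weighted Kotecký–Preiss condition
`∑_{v : c ∈ terr v} r_v e^{lam (|terr v| + diam terr v)} ≤ q` for every cell `c`, every Gibbs
measure `ν` of `γ` has, for bounded measurable observables `f, g` of the ordinary sites of cell
sets `Δf, Δg` at coarse distance `≥ D`,
`|ν(fg) - ν(f) ν(g)| ≤ C B_f B_g e^{|Δf|} |Δg| e^{-κₑ D}`. (With all territories singletons and
all activity events empty this is the covariance form of `annealed_influence_markov_defects`.)
[cite: BergMaes1994, §2] -/
def HyperCovDecaySpan (d : ℕ) : Prop :=
  ∀ n : ℕ, ∃ q₀ lam κₑ C : ℝ, 0 < q₀ ∧ 0 ≤ lam ∧ 0 < κₑ ∧ 0 ≤ C ∧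
    ∀ {μ : Fin d → ℕ} {V S : Type} [MeasurableSpace S] [Fintype V] [DecidableEq V]
      (cell : V → CoarseIdx μ) (terr : V → Finset (CoarseIdx μ)) (act : V → Set S)
      (γ : Specification V S) (good : CoarseIdx μ → Set (V → S)) (ν : Measure (V → S))
      (ε q : ℝ) (r : V → ℝ),
      (∀ i, 4 * n + 3 ≤ μ i + 1) → IsSpecification γ → IsGibbsMeasure γ ν →
      (∀ v, act v = ∅ → terr v = {cell v}) → (∀ v, MeasurableSet (act v)) →
      IsHyperMarkovV cell terr act γ →
      0 ≤ ε → ε * (shellCount d n : ℝ) ≤ 3 / 4 → IsGoodFSHyperV cell terr act γ good n ε →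
      0 ≤ q → q ≤ q₀ → (∀ v, 0 ≤ r v) → HyperPeierlsL cell terr act γ good q r →
      MarkRarity act γ r →
      (∀ c : CoarseIdx μ, ∑ v ∈ Finset.univ.filter (fun v => c ∈ terr v),
          r v * Real.exp (lam * tspan (terr v)) ≤ q) →
      ∀ (f g : (V → S) → ℝ) (Δf Δg : Finset (CoarseIdx μ)) (Bf Bg : ℝ) (D : ℕ),
        Measurable f → Measurable g → (∀ σ, |f σ| ≤ Bf) → (∀ σ, |g σ| ≤ Bg) →
        DependsOn f {v | act v = ∅ ∧ cell v ∈ Δf} → DependsOn g {v | act v = ∅ ∧ cell v ∈ Δg} →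
        (∀ x ∈ Δf, ∀ y ∈ Δg, D ≤ cdist x y) →
          |∫ σ, f σ * g σ ∂ν - (∫ σ, f σ ∂ν) * ∫ σ, g σ ∂ν| ≤
            C * Bf * Bg * Real.exp (Δf.card) * Δg.card * Real.exp (-(κₑ * D))

/-! ### The weighted Kotecký–Preiss entropy bound holds (discharge of `HyperKPBound`)

Appended 2026-08-27 (literature-prover, prim-rate-lit gen 62; D-0026 debt discharge, no new definitions or
named facts): `hyperKPBound_holds : HyperKPBound`, by a seed-removal recursion instead of the printed
component / tree-graph route — see the theorem's docstring. Private helper lemmas on `seedClosure` /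
`IsClusterShape` (monotonicity in the seed, seeds of non-empty shapes, seed removal) come first. -/

section HyperKPProof

variable {α : Type*} {adj : α → α → Prop}

/-- The seed closure is monotone in the seed set. [folklore] -/
private theorem seedClosure_mono_seed (B : Finset α) {S S' : Finset α} (h : S ⊆ S') :
    seedClosure adj B S ⊆ seedClosure adj B S' := fun c hc => by
  obtain ⟨hcB, s, hsS, hsB, hchain⟩ := mem_seedClosure.1 hc
  exact mem_seedClosure.2 ⟨hcB, s, h hsS, hsB, hchain⟩

/-- A cluster shape for a seed set is a cluster shape for every larger seed set. [folklore] -/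
private theorem IsClusterShape.mono_seed {S S' K : Finset α} (hK : IsClusterShape adj S K) (h : S ⊆ S') :
    IsClusterShape adj S' K :=
  Finset.Subset.antisymm (seedClosure_subset K S') fun c hc =>
    seedClosure_mono_seed K h (by rw [hK]; exact hc)

/-- A non-empty cluster shape contains a seed object. [folklore] -/
private theorem IsClusterShape.exists_seed {S K : Finset α} (hK : IsClusterShape adj S K)
    (hne : K.Nonempty) : ∃ s ∈ S, s ∈ K := by
  obtain ⟨c, hc⟩ := hne
  obtain ⟨s, hsS, hsK, -⟩ := hK.connected hc
  exact ⟨s, hsS, hsK⟩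

variable [DecidableEq α]

/-- **Seed removal.** Removing an object `s` from a cluster shape `K` for the seed `S` leaves a
cluster shape for the enlarged seed `S ∪ {objects of K ∖ {s} linked from s}`: a chain from a seed
object to `c ≠ s` inside `K` either avoids `s` or, after its last visit to `s`, restarts at an
object linked from `s`. [folklore] -/
private theorem IsClusterShape.erase {S K : Finset α} (hK : IsClusterShape adj S K) (s : α) :
    IsClusterShape adj (S ∪ (K.erase s).filter (fun y => adj s y)) (K.erase s) := by
  refine Finset.Subset.antisymm (seedClosure_subset _ _) fun c hc => ?_
  have hcK : c ∈ K := Finset.mem_of_mem_erase hc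
  have hcs : c ≠ s := Finset.ne_of_mem_erase hc
  obtain ⟨t, htS, htK, hchain⟩ := hK.connected hcK
  have key : ∀ y, Relation.ReflTransGen (fun x y => adj x y ∧ x ∈ K ∧ y ∈ K) t y →
      y = s ∨ y ∈ seedClosure adj (K.erase s) (S ∪ (K.erase s).filter (fun y => adj s y)) := by
    intro y hy
    induction hy with
    | refl =>
      by_cases hts : t = s
      · exact Or.inl hts
      · have ht' : t ∈ K.erase s := Finset.mem_erase.2 ⟨hts, htK⟩
        exact Or.inr (mem_seedClosure.2
          ⟨ht', t, Finset.mem_union_left _ htS, ht', Relation.ReflTransGen.refl⟩)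
    | @tail b c' _ hbc ih =>
      obtain ⟨hadj, -, hcK'⟩ := hbc
      by_cases hcs' : c' = s
      · exact Or.inl hcs'
      · refine Or.inr ?_
        have hc'' : c' ∈ K.erase s := Finset.mem_erase.2 ⟨hcs', hcK'⟩
        rcases ih with hbs | hb
        · rw [hbs] at hadj
          exact mem_seedClosure.2 ⟨hc'', c', Finset.mem_union_right _
            (Finset.mem_filter.2 ⟨hc'', hadj⟩), hc'', Relation.ReflTransGen.refl⟩
        · exact mem_seedClosure_of_adj hb hadj hc''
  rcases key c hchain with h | h
  · exact absurd h hcs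
  · exact h

end HyperKPProof

/-- **The weighted Kotecký–Preiss entropy bound holds** (`HyperKPBound`). Proof by removing one
SEED object `s ∈ Sd ∩ U` at a time (strong induction on `|U|`, the seed set generalised): the
non-empty cluster shapes `K ⊆ U` for `Sd` split into those avoiding `s` (cluster shapes in
`U ∖ {s}`) and those containing `s`, and for the latter `K ∖ {s}` is empty or a non-empty cluster
shape in `U ∖ {s}` for the seed `Sd ∪ N_U(s)` (`IsClusterShape.erase`), whence
`F(U, Sd) ≤ F(U∖{s}, Sd) + w s · (1 + F(U∖{s}, Sd ∪ N_U(s)))`; the bound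
`exp(∑_{Sd ∩ U} w e^a) - 1` is preserved because `∑_{N_U(s)} w e^a ≤ a s` (the Kotecký–Preiss
condition at `s`) and `1 + y ≤ e^y`. This replaces the printed route (connected components through
seed objects + the rooted tree-graph bound `∑_{C ∋ s} ∏ w ≤ w s e^{a s}` + the gas of components)
by a one-object recursion giving the same constant. [cite: KoteckyPreiss1986, (1)-(3)] -/
theorem hyperKPBound_holds : HyperKPBound := by
  intro α _ adj _ U Sd w a hw _ hKP
  suffices H : ∀ (n : ℕ) (U Sd : Finset α), U.card = n →
      (∀ o ∈ U, ∑ o' ∈ U.filter (fun o' => adj o o'), w o' * Real.exp (a o') ≤ a o) →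
      ∑ K ∈ U.powerset.filter (fun K => IsClusterShape adj Sd K ∧ K.Nonempty), ∏ o ∈ K, w o ≤
        Real.exp (∑ t ∈ U.filter (fun t => t ∈ Sd), w t * Real.exp (a t)) - 1 from
    H _ U Sd rfl hKP
  intro n
  refine Nat.strong_induction_on n fun n ih => ?_
  intro U Sd hcard hKPU
  have hwe : ∀ o, 0 ≤ w o * Real.exp (a o) := fun o => mul_nonneg (hw o) (Real.exp_pos _).le
  by_cases hseed : ∃ s ∈ U, s ∈ Sd
  swap
  · -- no seed object in `U`: no non-empty cluster shape inside `U`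
    have hempty : U.powerset.filter (fun K => IsClusterShape adj Sd K ∧ K.Nonempty) = ∅ := by
      refine Finset.filter_false_of_mem fun K hK hP => hseed ?_
      obtain ⟨s, hsS, hsK⟩ := hP.1.exists_seed hP.2
      exact ⟨s, Finset.mem_powerset.1 hK hsK, hsS⟩
    have hempty' : U.filter (fun t => t ∈ Sd) = ∅ :=
      Finset.filter_false_of_mem fun s hsU hsS => hseed ⟨s, hsU, hsS⟩
    simp [hempty, hempty']
  obtain ⟨s, hsU, hsSd⟩ := hseed
  set U' := U.erase s with hU'
  have hsU' : s ∉ U' := Finset.notMem_erase s U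
  have hUeq : U = insert s U' := (Finset.insert_erase hsU).symm
  have hcard' : U'.card < n := hcard ▸ Finset.card_erase_lt_of_mem hsU
  -- the Kotecký–Preiss condition restricts to `U'`
  have hKPU' : ∀ o ∈ U', ∑ o' ∈ U'.filter (fun o' => adj o o'), w o' * Real.exp (a o') ≤ a o := by
    intro o ho
    refine le_trans (Finset.sum_le_sum_of_subset_of_nonneg
      (Finset.filter_subset_filter _ (Finset.erase_subset s U)) fun o' _ _ => hwe o') ?_
    exact hKPU o (Finset.mem_of_mem_erase ho)
  set N := U.filter (fun o' => adj s o') with hN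
  set X := ∑ t ∈ U'.filter (fun t => t ∈ Sd), w t * Real.exp (a t) with hX
  have ih1 := ih U'.card hcard' U' Sd rfl hKPU'
  have ih2 := ih U'.card hcard' U' (Sd ∪ N) rfl hKPU'
  -- the seed sum over `U` splits off `s`
  have hsumU : ∑ t ∈ U.filter (fun t => t ∈ Sd), w t * Real.exp (a t) =
      w s * Real.exp (a s) + X := by
    rw [hUeq, Finset.filter_insert, if_pos hsSd,
      Finset.sum_insert (fun h => hsU' (Finset.mem_filter.1 h).1)]
  -- the seed sum for `Sd ∪ N` over `U'` is at most `X + a s` (Kotecký–Preiss at `s`)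
  have hsum2 : ∑ t ∈ U'.filter (fun t => t ∈ Sd ∪ N), w t * Real.exp (a t) ≤ X + a s := by
    have hsplit : U'.filter (fun t => t ∈ Sd ∪ N) =
        U'.filter (fun t => t ∈ Sd) ∪ U'.filter (fun t => t ∈ N) := by
      ext t; simp only [Finset.mem_filter, Finset.mem_union]; tauto
    have hNs : ∑ t ∈ U'.filter (fun t => t ∈ N), w t * Real.exp (a t) ≤ a s := by
      refine le_trans (Finset.sum_le_sum_of_subset_of_nonneg (fun t ht => (Finset.mem_filter.1 ht).2)
        fun o' _ _ => hwe o') ?_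
      exact hKPU s hsU
    have hui := Finset.sum_union_inter (s₁ := U'.filter (fun t => t ∈ Sd))
      (s₂ := U'.filter (fun t => t ∈ N)) (f := fun t => w t * Real.exp (a t))
    have hint : 0 ≤ ∑ t ∈ U'.filter (fun t => t ∈ Sd) ∩ U'.filter (fun t => t ∈ N),
        w t * Real.exp (a t) := Finset.sum_nonneg fun t _ => hwe t
    rw [hsplit]
    linarith
  -- split the shape sum over `U = insert s U'` according to `s ∈ K`
  have hF : ∑ K ∈ U.powerset.filter (fun K => IsClusterShape adj Sd K ∧ K.Nonempty), ∏ o ∈ K, w o =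
      ∑ K ∈ U'.powerset, (if IsClusterShape adj Sd K ∧ K.Nonempty then ∏ o ∈ K, w o else 0) +
        ∑ K ∈ U'.powerset, (if IsClusterShape adj Sd (insert s K) ∧ (insert s K).Nonempty then
          ∏ o ∈ insert s K, w o else 0) := by
    rw [Finset.sum_filter, hUeq, Finset.sum_powerset_insert hsU']
  have h1 : ∑ K ∈ U'.powerset, (if IsClusterShape adj Sd K ∧ K.Nonempty then ∏ o ∈ K, w o else 0) ≤
      Real.exp X - 1 := by
    rw [← Finset.sum_filter]; exact ih1
  -- termwise: a shape containing `s` is `{s}` or `{s} ∪` a non-empty shape for `Sd ∪ N` in `U'`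
  have hterm : ∀ K ∈ U'.powerset,
      (if IsClusterShape adj Sd (insert s K) ∧ (insert s K).Nonempty then ∏ o ∈ insert s K, w o
        else 0) ≤
        w s * ((if K = ∅ then 1 else 0) +
          (if IsClusterShape adj (Sd ∪ N) K ∧ K.Nonempty then ∏ o ∈ K, w o else 0)) := by
    intro K hK
    have hKU' : K ⊆ U' := Finset.mem_powerset.1 hK
    have hsK : s ∉ K := fun h => hsU' (hKU' h)
    have hprod : 0 ≤ ∏ o ∈ K, w o := Finset.prod_nonneg fun o _ => hw o
    have h0 : (0 : ℝ) ≤ (if K = ∅ then 1 else 0) := by split_ifs <;> norm_num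
    have h0' : (0 : ℝ) ≤ (if IsClusterShape adj (Sd ∪ N) K ∧ K.Nonempty then ∏ o ∈ K, w o else 0) := by
      split_ifs
      · exact hprod
      · exact le_rfl
    by_cases hP : IsClusterShape adj Sd (insert s K) ∧ (insert s K).Nonempty
    · rw [if_pos hP, Finset.prod_insert hsK]
      by_cases hK0 : K = ∅
      · subst hK0
        rw [if_pos rfl, Finset.prod_empty, if_neg (fun h => Finset.not_nonempty_empty h.2)]
        simp
      · have hne : K.Nonempty := Finset.nonempty_iff_ne_empty.2 hK0
        have hshape : IsClusterShape adj (Sd ∪ N) K := by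
          have h := hP.1.erase s
          rw [Finset.erase_insert hsK] at h
          exact h.mono_seed (Finset.union_subset_union (le_refl _)
            (Finset.filter_subset_filter _ (hKU'.trans (Finset.erase_subset s U))))
        rw [if_neg hK0, if_pos ⟨hshape, hne⟩, zero_add]
    · rw [if_neg hP]
      exact mul_nonneg (hw s) (add_nonneg h0 h0')
  have h2 : ∑ K ∈ U'.powerset, (if IsClusterShape adj Sd (insert s K) ∧ (insert s K).Nonempty then
      ∏ o ∈ insert s K, w o else 0) ≤ w s * Real.exp (X + a s) := by
    calc ∑ K ∈ U'.powerset, (if IsClusterShape adj Sd (insert s K) ∧ (insert s K).Nonempty then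
            ∏ o ∈ insert s K, w o else 0)
        ≤ ∑ K ∈ U'.powerset, w s * ((if K = ∅ then 1 else 0) +
            (if IsClusterShape adj (Sd ∪ N) K ∧ K.Nonempty then ∏ o ∈ K, w o else 0)) :=
          Finset.sum_le_sum hterm
      _ = w s * (1 + ∑ K ∈ U'.powerset.filter (fun K => IsClusterShape adj (Sd ∪ N) K ∧ K.Nonempty),
            ∏ o ∈ K, w o) := by
          rw [← Finset.mul_sum, Finset.sum_add_distrib, Finset.sum_ite_eq' U'.powerset ∅ (fun _ => (1 : ℝ)),
            if_pos (Finset.empty_mem_powerset U'), Finset.sum_filter]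
      _ ≤ w s * (1 + (Real.exp (∑ t ∈ U'.filter (fun t => t ∈ Sd ∪ N), w t * Real.exp (a t)) - 1)) :=
          mul_le_mul_of_nonneg_left (by linarith [ih2]) (hw s)
      _ ≤ w s * (1 + (Real.exp (X + a s) - 1)) :=
          mul_le_mul_of_nonneg_left (by linarith [Real.exp_le_exp.2 hsum2]) (hw s)
      _ = w s * Real.exp (X + a s) := by ring
  calc ∑ K ∈ U.powerset.filter (fun K => IsClusterShape adj Sd K ∧ K.Nonempty), ∏ o ∈ K, w o
      = _ := hF
    _ ≤ (Real.exp X - 1) + w s * Real.exp (X + a s) := add_le_add h1 h2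
    _ = Real.exp X * (w s * Real.exp (a s) + 1) - 1 := by rw [Real.exp_add]; ring
    _ ≤ Real.exp X * Real.exp (w s * Real.exp (a s)) - 1 :=
        sub_le_sub_right (mul_le_mul_of_nonneg_left (Real.add_one_le_exp _) (Real.exp_pos X).le) 1
    _ = Real.exp (∑ t ∈ U.filter (fun t => t ∈ Sd), w t * Real.exp (a t)) - 1 := by
        rw [hsumU, Real.exp_add, mul_comm]

/-- `HyperKPBound` — `_holds` alias of `hyperKPBound_holds` above under the fact's exact name (appended
2026-08-28, D-0026 bookkeeping: the proof term is the existing theorem of this file; no statement,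
definition or attribute is edited; no new named fact; the ledger's debt table listed the fact
unproved). [cite: KoteckyPreiss1986, (1)-(3)] -/
theorem _root_.Literature.Probability.LatticeModels.HyperKPBound_holds : HyperKPBound :=
  _root_.Literature.Probability.LatticeModels.hyperKPBound_holds

end Literature.Probability.LatticeModels
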